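import Literature.Analysis.FluidPDE.GaussianVortexFormDomainPoincare
import Mathlib.Analysis.Calculus.BumpFunction.InnerProduct
import HarnessLib

/-!
# Constants belong to the form domain `H¹(μ_λ)`

Analysis/FluidPDE file (all results proved, no definitions, no named facts), part of the linear
theory behind the named fact `GallayMaekawa2016_thm41` (Gallay–Maekawa 2016, Thm. 4.1):

* `norm_sq_Lp_two_eq_integral(_vec)` — squared norms in `L²(μ_λ)`, `L²(μ_λ; ℝ²)` as integrals;
* `one_mem_gaussLamFormDomain` — **`(1, 0) ∈ H¹(μ_λ)`**: for a bump `χ` equal to `1` on the unit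
  ball, the cut-offs `χₙ(x) = χ(x/(n+1))` are test functions with `χₙ → 1` in `L²(μ_λ)` (dominated
  convergence, `μ_λ` finite for `λ ∈ [0,1)`) and `‖∇χₙ‖_{L²(μ_λ)} ≤ ‖Dχ‖_∞ μ_λ(ℝ²)^{1/2}/(n+1) → 0`,
  so their graphs converge to `(1, 0)`, which lies in the closed subspace `H¹(μ_λ)`. This is what
  allows the Lax–Milgram solution on the mean-zero subspace to be tested against ALL of `H¹(μ_λ)`
  (`GaussianVortexLinearLamSolver`): the compatibility condition `∫ g dμ_λ = 0` is exactly
  orthogonality to this vector.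

## References

* Th. Gallay, Y. Maekawa, *Existence and stability of viscous vortices*, arXiv:1610.08384, §4.1.
  [GallayMaekawa2016]
-/

open MeasureTheory Filter Set WithLp Metric
open scoped Real RealInnerProductSpace Topology InnerProductSpace ContDiff Laplacian

noncomputable section

namespace Literature.Analysis.FluidPDE

open Literature.Analysis.UnboundedOperators

variable {lam : ℝ}

/-! ### Squared norms in `L²(μ_λ)` as integrals -/

section Norms

variable (lam)

/-- `‖v‖² = ∫ v² dμ_λ` in `L²(μ_λ)`. [folklore] -/
theorem norm_sq_Lp_two_eq_integral (v : Lp ℝ 2 (gaussLamMeasure lam)) :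
    ‖v‖ ^ 2 = ∫ x, (v : EuclideanSpace ℝ (Fin 2) → ℝ) x ^ 2 ∂gaussLamMeasure lam := by
  rw [← real_inner_self_eq_norm_sq, L2.inner_def]
  refine integral_congr_ae (Eventually.of_forall fun x => ?_)
  simp only [RCLike.inner_apply, conj_trivial]
  ring

/-- `‖G‖² = ∫ ‖G‖² dμ_λ` in `L²(μ_λ; ℝ²)`. [folklore] -/
theorem norm_sq_Lp_two_eq_integral_vec (G : Lp (EuclideanSpace ℝ (Fin 2)) 2 (gaussLamMeasure lam)) :
    ‖G‖ ^ 2 = ∫ x, ‖(G : EuclideanSpace ℝ (Fin 2) → EuclideanSpace ℝ (Fin 2)) x‖ ^ 2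
      ∂gaussLamMeasure lam := by
  rw [← real_inner_self_eq_norm_sq, L2.inner_def]
  refine integral_congr_ae (Eventually.of_forall fun x => ?_)
  simp only
  rw [real_inner_self_eq_norm_sq]

end Norms

/-! ### Constants belong to `H¹(μ_λ)` -/

section Constants

variable (hlam : lam ∈ Set.Ico (0 : ℝ) 1)
include hlam

/-- **Constants lie in the form domain**: `(1, 0) ∈ H¹(μ_λ)`. Proof: for a bump `χ` with `χ = 1`
on the unit ball, the cut-offs `χₙ(x) = χ(x/(n+1))` are test functions with `χₙ → 1` in `L²(μ_λ)`
(dominated convergence, `μ_λ` finite) and `‖∇χₙ‖_{L²(μ_λ)} ≤ ‖Dχ‖_∞ μ_λ(ℝ²)^{1/2}/(n+1) → 0`.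
[folklore] -/
theorem one_mem_gaussLamFormDomain :
    (toLp 2 (gaussLamOne hlam, 0) : WithLp 2 (Lp ℝ 2 (gaussLamMeasure lam) ×
      Lp (EuclideanSpace ℝ (Fin 2)) 2 (gaussLamMeasure lam))) ∈ gaussLamFormDomain lam := by
  haveI := isFiniteMeasure_gaussLamMeasure hlam
  have hρi := integrable_expNegQuadLam hlam
  -- a fixed bump, `= 1` on the closed unit ball
  let χ : ContDiffBump (0 : EuclideanSpace ℝ (Fin 2)) := ⟨1, 2, one_pos, one_lt_two⟩
  have hχc : ContDiff ℝ ∞ (χ : EuclideanSpace ℝ (Fin 2) → ℝ) := χ.contDiff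
  have hχs : HasCompactSupport (χ : EuclideanSpace ℝ (Fin 2) → ℝ) := χ.hasCompactSupport
  obtain ⟨K, hK⟩ := (hχc.continuous_fderiv (by simp)).bounded_above_of_compact_support
    (hχs.fderiv (𝕜 := ℝ))
  have hK0 : 0 ≤ K := (norm_nonneg _).trans (hK 0)
  -- the rescaled cut-offs
  have hmem : ∀ n : ℕ, (fun x : EuclideanSpace ℝ (Fin 2) => χ (((n : ℝ) + 1)⁻¹ • x)) ∈
      planarTestFunctions := fun n =>
    ⟨hχc.comp (contDiff_const_smul _), hχs.comp_smul (inv_ne_zero (by positivity))⟩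
  set ψ : ℕ → planarTestFunctions := fun n => ⟨_, hmem n⟩ with hψ
  have hψ_apply : ∀ (n : ℕ) (x : EuclideanSpace ℝ (Fin 2)),
      (ψ n : EuclideanSpace ℝ (Fin 2) → ℝ) x = χ (((n : ℝ) + 1)⁻¹ • x) := fun n x => rfl
  -- derivative of the cut-offs
  have hDψ : ∀ (n : ℕ) (x : EuclideanSpace ℝ (Fin 2)),
      ‖fderiv ℝ (ψ n : EuclideanSpace ℝ (Fin 2) → ℝ) x‖ ≤ K * ((n : ℝ) + 1)⁻¹ := by
    intro n x
    set c : ℝ := ((n : ℝ) + 1)⁻¹ with hc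
    have hcpos : 0 < c := by positivity
    have hd : HasFDerivAt (ψ n : EuclideanSpace ℝ (Fin 2) → ℝ)
        ((fderiv ℝ (χ : EuclideanSpace ℝ (Fin 2) → ℝ) (c • x)).comp
          (c • ContinuousLinearMap.id ℝ (EuclideanSpace ℝ (Fin 2)))) x := by
      have h1 : HasFDerivAt (fun y : EuclideanSpace ℝ (Fin 2) => c • y)
          (c • ContinuousLinearMap.id ℝ (EuclideanSpace ℝ (Fin 2))) x :=
        (hasFDerivAt_id x).const_smul c
      exact ((hχc.differentiable (by simp)) (c • x)).hasFDerivAt.comp x h1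
    rw [hd.fderiv]
    calc ‖(fderiv ℝ (χ : EuclideanSpace ℝ (Fin 2) → ℝ) (c • x)).comp
          (c • ContinuousLinearMap.id ℝ (EuclideanSpace ℝ (Fin 2)))‖
        ≤ ‖fderiv ℝ (χ : EuclideanSpace ℝ (Fin 2) → ℝ) (c • x)‖ *
          ‖c • ContinuousLinearMap.id ℝ (EuclideanSpace ℝ (Fin 2))‖ :=
          ContinuousLinearMap.opNorm_comp_le _ _
      _ ≤ K * c := by
          refine mul_le_mul (hK _) ?_ (norm_nonneg _) hK0
          rw [norm_smul, Real.norm_of_nonneg hcpos.le]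
          exact mul_le_of_le_one_right hcpos.le ContinuousLinearMap.norm_id_le
  -- (i) the first components converge to `1` in `L²(μ_λ)`
  have h1 : Tendsto (fun n => (gaussLamGraph lam (ψ n)).fst) atTop (𝓝 (gaussLamOne hlam)) := by
    rw [tendsto_iff_norm_sub_tendsto_zero]
    have hsq : ∀ n, ‖(gaussLamGraph lam (ψ n)).fst - gaussLamOne hlam‖ ^ 2 =
        ∫ x, (χ (((n : ℝ) + 1)⁻¹ • x) - 1) ^ 2 *
          Real.exp (-((1 + lam) / 4 * x 0 ^ 2 + (1 - lam) / 4 * x 1 ^ 2)) := by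
      intro n
      rw [norm_sq_Lp_two_eq_integral, integral_gaussLamMeasure]
      refine integral_congr_ae ((ae_gaussLamMeasure_iff lam).1 ?_)
      filter_upwards [Lp.coeFn_sub (gaussLamGraph lam (ψ n)).fst (gaussLamOne hlam),
        MemLp.coeFn_toLp (memLp_planarTestFunction lam (ψ n)), gaussLamOne_ae_eq hlam]
        with x hx h2 h3
      rw [hx, Pi.sub_apply, gaussLamGraph_fst, h2, h3, hψ_apply]
    have hlim : Tendsto (fun n : ℕ => ∫ x, (χ (((n : ℝ) + 1)⁻¹ • x) - 1) ^ 2 *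
        Real.exp (-((1 + lam) / 4 * x 0 ^ 2 + (1 - lam) / 4 * x 1 ^ 2))) atTop (𝓝 0) := by
      have h := tendsto_integral_of_dominated_convergence
        (μ := (volume : Measure (EuclideanSpace ℝ (Fin 2))))
        (F := fun (n : ℕ) (x : EuclideanSpace ℝ (Fin 2)) => (χ (((n : ℝ) + 1)⁻¹ • x) - 1) ^ 2 *
          Real.exp (-((1 + lam) / 4 * x 0 ^ 2 + (1 - lam) / 4 * x 1 ^ 2)))
        (f := fun _ => 0)
        (fun x => Real.exp (-((1 + lam) / 4 * x 0 ^ 2 + (1 - lam) / 4 * x 1 ^ 2)))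
        (fun n => ((((χ.continuous.comp (continuous_const_smul _)).sub continuous_const).pow 2).mul
          (continuous_expNegQuadLam lam)).aestronglyMeasurable) hρi
        (fun n => Eventually.of_forall fun x => ?_) (Eventually.of_forall fun x => ?_)
      · simpa using h
      · -- `|(χₙ − 1)² ρ| ≤ ρ`
        have h01 : 0 ≤ χ (((n : ℝ) + 1)⁻¹ • x) := χ.nonneg
        have h11 : χ (((n : ℝ) + 1)⁻¹ • x) ≤ 1 := χ.le_one
        have hρx := (Real.exp_pos (-((1 + lam) / 4 * x 0 ^ 2 + (1 - lam) / 4 * x 1 ^ 2))).le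
        rw [Real.norm_of_nonneg (by positivity)]
        have hsq1 : (χ (((n : ℝ) + 1)⁻¹ • x) - 1) ^ 2 ≤ 1 := by nlinarith
        calc (χ (((n : ℝ) + 1)⁻¹ • x) - 1) ^ 2 *
              Real.exp (-((1 + lam) / 4 * x 0 ^ 2 + (1 - lam) / 4 * x 1 ^ 2))
            ≤ 1 * Real.exp (-((1 + lam) / 4 * x 0 ^ 2 + (1 - lam) / 4 * x 1 ^ 2)) :=
              mul_le_mul_of_nonneg_right hsq1 hρx
          _ = _ := one_mul _
      · -- eventually `χₙ(x) = 1`, so the integrand vanishes at `x`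
        refine (tendsto_const_nhds (x := (0 : ℝ))).congr' ?_
        refine Filter.eventually_atTop.2 ⟨⌈‖x‖⌉₊, fun n hn => ?_⟩
        have hnx : ‖x‖ ≤ (n : ℝ) + 1 := by
          have h1 : ‖x‖ ≤ (⌈‖x‖⌉₊ : ℝ) := Nat.le_ceil _
          have h2 : (⌈‖x‖⌉₊ : ℝ) ≤ n := by exact_mod_cast hn
          linarith
        have hball : ((n : ℝ) + 1)⁻¹ • x ∈ closedBall (0 : EuclideanSpace ℝ (Fin 2)) χ.rIn := by
          rw [mem_closedBall, dist_zero_right, norm_smul, Real.norm_of_nonneg (by positivity)]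
          show ((n : ℝ) + 1)⁻¹ * ‖x‖ ≤ 1
          rw [inv_mul_le_iff₀ (by positivity)]
          linarith
        simp only [χ.one_of_mem_closedBall hball, sub_self, ne_eq, OfNat.ofNat_ne_zero,
          not_false_eq_true, zero_pow, zero_mul]
    have h0 : Tendsto (fun n => ‖(gaussLamGraph lam (ψ n)).fst - gaussLamOne hlam‖ ^ 2)
        atTop (𝓝 0) := by
      simp_rw [hsq]; exact hlim
    have := (Real.continuous_sqrt.tendsto 0).comp h0
    simpa [Function.comp_def, Real.sqrt_sq (norm_nonneg _)] using this
  -- (ii) the gradients converge to `0` in `L²(μ_λ; ℝ²)`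
  have h2 : Tendsto (fun n => (gaussLamGraph lam (ψ n)).snd) atTop (𝓝 0) := by
    rw [tendsto_zero_iff_norm_tendsto_zero]
    set Z : ℝ := ∫ x : EuclideanSpace ℝ (Fin 2),
      Real.exp (-((1 + lam) / 4 * x 0 ^ 2 + (1 - lam) / 4 * x 1 ^ 2)) with hZ
    have hZ0 : 0 ≤ Z := integral_nonneg fun x => (Real.exp_pos _).le
    have hbound : ∀ n : ℕ, ‖(gaussLamGraph lam (ψ n)).snd‖ ≤ K * ((n : ℝ) + 1)⁻¹ * Real.sqrt Z := by
      intro n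
      have hsq : ‖(gaussLamGraph lam (ψ n)).snd‖ ^ 2 ≤ (K * ((n : ℝ) + 1)⁻¹ * Real.sqrt Z) ^ 2 := by
        rw [norm_sq_gaussLamGraph_snd, mul_pow, Real.sq_sqrt hZ0, hZ, ← integral_const_mul]
        refine integral_mono ?_ (hρi.const_mul _) fun x => ?_
        · exact hρi.bdd_mul ((((planarTestFunctions.contDiff (ψ n)).continuous_fderiv
            (by simp)).norm.pow 2).aestronglyMeasurable) (Eventually.of_forall fun x => by
            rw [norm_pow, norm_norm]
            exact pow_le_pow_left₀ (norm_nonneg _) (hDψ n x) 2)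
        · exact mul_le_mul_of_nonneg_right (pow_le_pow_left₀ (norm_nonneg _) (hDψ n x) 2)
            (Real.exp_pos _).le
      exact (pow_le_pow_iff_left₀ (norm_nonneg _) (by positivity) two_ne_zero).1 hsq
    have hlim : Tendsto (fun n : ℕ => K * ((n : ℝ) + 1)⁻¹ * Real.sqrt Z) atTop (𝓝 0) := by
      have h := tendsto_one_div_add_atTop_nhds_zero_nat (𝕜 := ℝ)
      have : Tendsto (fun n : ℕ => K * (1 / ((n : ℝ) + 1)) * Real.sqrt Z) atTop (𝓝 (K * 0 * Real.sqrt Z)) :=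
        (h.const_mul K).mul_const _
      simpa [one_div] using this
    exact squeeze_zero (fun n => norm_nonneg _) hbound hlim
  -- (iii) hence the graphs converge to `(1, 0)`, which therefore lies in the closed subspace
  have hc : Continuous fun q : Lp ℝ 2 (gaussLamMeasure lam) ×
      Lp (EuclideanSpace ℝ (Fin 2)) 2 (gaussLamMeasure lam) =>
      (toLp 2 q : WithLp 2 (Lp ℝ 2 (gaussLamMeasure lam) ×
        Lp (EuclideanSpace ℝ (Fin 2)) 2 (gaussLamMeasure lam))) := by
    exact (WithLp.prodContinuousLinearEquiv 2 ℝ (Lp ℝ 2 (gaussLamMeasure lam))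
      (Lp (EuclideanSpace ℝ (Fin 2)) 2 (gaussLamMeasure lam))).symm.continuous.congr fun q => rfl
  have hlim : Tendsto (fun n => gaussLamGraph lam (ψ n)) atTop
      (𝓝 (toLp 2 (gaussLamOne hlam, 0))) := by
    have h := (hc.tendsto _).comp (h1.prodMk_nhds h2)
    exact h
  exact (isClosed_gaussLamFormDomain lam).mem_of_tendsto hlim
    (Eventually.of_forall fun n => gaussLamGraph_mem lam (ψ n))

end Constants

end Literature.Analysis.FluidPDE
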